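/-
Copyright (c) 2026 the pub-hodgecm-mathlib formalisation cell (harness21).  Typist seat hodgecm-mathlib-R90-C10-typ1 (g4), R90-TF section S1 «Ch10-local» (A-file pen by lineage);
authored 2026-09-05 (offer (o1b), S1 dealer R90-C10-plan (g2) R-S1-19 (2) «= in principle, typed ONLY against ED. 10 AS WRITTEN»); filer = the prover hand the dealer names (this seat proposes no theorems).
KERNEL module: THEOREMS ONLY (no definition, no named fact, no `sorry`, no instance, no notation).  ONE theorem.
-/
import Summits.HodgeConjecture.HodgeConjecture.Theorems.K2E3BranchAIrreducibleTwoDepthLeaf   -- ★ p863367∕p863432 (K2E3-p34 (g2)): Branch A at positive depth is IRREDUCIBLE at every unramified (`…_of_traceOne`) ∕ tame (`…_of_v_two`) non-split place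
import Summits.HodgeConjecture.HodgeConjecture.Theorems.K2E3LocalTraceOneLetter           -- ★ p862457 (K2E3-p32 (g2)): `exists_traceOne_local_of_isUnramifiedIn_of_nonsplit` — the integral trace-one element at an unramified non-split place
import HarnessLib

/-!
# R90-TF · S1 «Ch10-local» — THE LETTER :182 (U4f-χ₁-ram-one-pos) AS A FUNCTION OF EXACTLY ITS THREE OPEN PLACE-SOCKETS (law L9 THEOREMS TWIN of the U4Keys ED. 10 tie):
# Keys' Theorem §7 (2) («`Re s > 0`» form) for a RAMIFIED `χ₁` of POSITIVE DEPTH at `χ₂ = 1`, every non-split place ⟸ (S-I) inert Branch B ∧ (S-RT) tame-ramified Branch B ∧ (S-W) wild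
# [Keys1984 §7 Thm (2) p. 126; Rogawski1990 §12.2 (1)–(2) p. 173; Roche1998 §3–§4; Casselman1995 §6.4]

Cell `pub/hodgecm-mathlib`, crux H413 = `stmt-HodgeConjecture-24833`, route of record `HCCMUnconditional` (no route verbs); R90-TF section S1, companion of (o1a)
`Theorems/R90S1KeysThmTwoRamifiedCharOneOfPosDepth.lean :: R90.S1.keysThmTwo_ramifiedCharOne_of_posDepth (hPos : <:182 ∀-text>) : <A2′ ∀-closed>` (audit box CLEAN 2026-09-05T00:51:22Z).
THEOREMS ONLY; lane `--supports stmt-HodgeConjecture-24833 --as helper`, count-neutral.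

WHAT THIS FILE IS.  The K2 E3 organ `Cruxes/H413/Lines/K2_E3_EllipticInputsSigs_U4Keys.lean` ED. 10 (K2E3-plan (g6), WRITTEN @91f7ef67a7f0, tree sha16 6a291b9cdeae7634) ties its socket
:289 `sig_K2E3KeysThmTwoContractingRamifiedCharOnePosDepth` (the letter «:182» (U4f-χ₁-ram-one-pos) of earlier editions) RELATIVELY, PLACE-FIRST, over EXACTLY three sockets: (S-I) :192
`sig_…PosDepthNormTrivialInert` (inert, Branch B; payer of record S1 (B-7⁺) `R90.S1.…KeysThmTwoPosDepthBranchBInertAllLeaf` unlettered head by ONE `Or.inr`, junction cert 8fc5a3d1f6bb751c CLEAN),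
(S-RT) :223 `sig_…PosDepthNormTrivialRamifiedTame` (tame-ramified, Branch B; payer S1 leaf (8) `R90.S1.exists_eta_of_reducible_posDepth_normTrivial_ramifiedTame`, head frozen fa479885beeb3078),
(S-W) :261 `sig_…PosDepthWild` (wild dyadic, both branches; E3ʼs XL residual, roads priced, no hand) — Branch A (`χ₁(u·σu) ≠ 1` for a unit `u`) being ABSURD at every unramified ∕ tame place by
★ p863367∕p863432 `K2E3BranchAIrreducibleTwoDepthLeaf` (with the integral trace-one element of ★ p862457 at an unramified place, `t := 2⁻¹` at a tame one).  S1 pays file Aʼs socket A2′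
LINES-FREE (law L9), so the tie is needed THEOREMS-SIDE: this module is its THEOREMS TWIN, HYPOTHESIS-FIRST — the three open sockets are the hypotheses `hSI hSRT hSW` (their ∀-texts VERBATIM
from the WRITTEN tree bytes :193–:206, :224–:238, :262–:274), the conclusion is the ∀-text of :289 (:290–:300) VERBATIM, and the body is ED. 10ʼs tactic block :301–:322 with the three socket
names replaced by the three letters (★ names unchanged).  AFTER BOTH TWINS: A ED. 3ʼs A2′ line = `stub_R90_122_keysThmTwo_ramifiedCharOne v hns :=
R90.S1.keysThmTwo_ramifiedCharOne_of_posDepth (R90.S1.keysThmTwo_posDepth_of_letters sI sRT sW) L v hns` the day ★ payers `sI sRT sW` of the three socket types exist (today: none ★ —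
(S-I) HE-discharge in flight, (S-RT) leaf (8) after P-ram-1, (S-W) unstaffed).
HONEST LABEL.  HC_CM is proved only modulo the 7 printed citations (2 remaining named inputs: hLiu418 = `stmt-HodgeConjecture-24832`, h413 = `stmt-HodgeConjecture-24833`) until rung 0
closes; count-neutral — a hypothesis-first twin RE-EXPRESSES the open letter :182 as EXACTLY its three open place-sockets and closes NOTHING: (S-I) ∕ (S-RT) ∕ (S-W) ∕ :182 ∕ A2′ stay OPEN;
no printed citation is discharged; REL ≠ ★ ≠ BUILT.

## References
* [Keys1984] D. Keys, *Principal series representations of special unitary groups over local fields*, Compositio Math. 51 (1984), §3, §7 Theorem (2) p. 126.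
* [Rogawski1990] J. D. Rogawski, *Automorphic Representations of Unitary Groups in Three Variables*, Ann. of Math. Stud. 123 (1990), §12.1 p. 171, §12.2 (1)–(2) p. 173.
* [Roche1998] A. Roche, *Types and Hecke algebras for principal series representations of split reductive p-adic groups*, Ann. Sci. ÉNS (4) 31 (1998), §3–§4.
* [Casselman1995] W. Casselman, *Introduction to the theory of admissible representations of `p`-adic reductive groups* (1995), §6.4, Thm. 6.6.2.
* [MoyPrasad1996] A. Moy, G. Prasad, *Jacquet functors and unrefined minimal K-types*, Comment. Math. Helv. 71 (1996), §3.
-/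

set_option autoImplicit false
-- the mandated namespace has the single-problem summit's repeated segment (`HodgeConjecture.HodgeConjecture`)
set_option linter.dupNamespace false

noncomputable section

open NumberField IsDedekindDomain MeasureTheory
open scoped Matrix MatrixGroups WithZero Valued NNReal
open Literature.NumberTheory Literature.NumberTheory.Automorphic Literature.NumberTheory.Automorphic.UnitaryGroup

namespace Summit.HodgeConjecture.HodgeConjecture.R90.S1

open Summit.HodgeConjecture.HodgeConjecture.Cruxes.H413

set_option maxHeartbeats 1600000 in            -- as the organ U4Keys sets per socket (three socket-sized hypotheses + the :182 conclusion; default 200 000 times out at `isDefEq` on the statement)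
set_option synthInstance.maxHeartbeats 400000 in
/-- **KEYS' THEOREM §7 (2) («`Re s > 0`» form), RAMIFIED `χ₁` OF POSITIVE DEPTH, `χ₂ = 1`, EVERY NON-SPLIT PLACE ⟸ ITS THREE PLACE-SOCKETS** — the letter :182 (= the ∀-text of
`…U4Keys.sig_K2E3KeysThmTwoContractingRamifiedCharOnePosDepth` TOKEN FOR TOKEN) from `hSI` (= ∀-text of `…U4Keys.sig_K2E3KeysThmTwoContractingRamifiedCharOnePosDepthNormTrivialInert`),
`hSRT` (= ∀-text of `…sig_K2E3KeysThmTwoContractingRamifiedCharOnePosDepthNormTrivialRamifiedTame`) and `hSW` (= ∀-text of `…sig_K2E3KeysThmTwoContractingRamifiedCharOnePosDepthWild`), all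
TOKEN FOR TOKEN from ED. 10 AS WRITTEN: `v` non-split in the CM field `L`; `χ₁ : (L ⊗ L⁺_v)ˣ → ℂˣ` continuous, non-unitary, contracting, not trivial on the integral units, NOT trivial on the
principal units (`hpos`); if `i(χ₁, 1)` is reducible then `χ₁ = ‖·‖` or `χ₁ = η · ‖·‖^{1∕2}`.  PROOF (= U4Keys ED. 10ʼs tie, Theorems-side): `by_cases` `v` unramified in `L` — Branch B → `hSI` ∣
Branch A ABSURD (★ `not_reducible_of_posDepth_of_normChar_ne_one_of_traceOne` with the trace-one element of ★ `exists_traceOne_local_of_isUnramifiedIn_of_nonsplit`); else `by_cases` `|2|_{w′} = 1`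
for all `w′` — Branch B → `hSRT` ∣ Branch A ABSURD (★ `…_of_v_two`); else → `hSW`.
[cite: Keys1984, §7 Theorem (2) p. 126] [cite: Rogawski1990, §12.2 (1)–(2) p. 173] [cite: Roche1998, §3–§4] [cite: Casselman1995, §6.4, Thm. 6.6.2] -/
theorem keysThmTwo_posDepth_of_letters
    (hSI :
      ∀ (L : Type) [Field L] [NumberField L] [IsCMField L] (v : HeightOneSpectrum (𝓞 ↥(maximalRealSubfield L))),
          (∀ w : PlacesOver L v, IsCMField.complexConj L • w.1 = w.1) →
          Algebra.IsUnramifiedIn (𝓞 L) v.asIdeal →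
          ∀ (χ₁ : (UnitaryGroup.LocalRing L v)ˣ →* ℂˣ),
            Continuous (fun x => ((χ₁ x : ℂˣ) : ℂ)) → (∃ x, ‖((χ₁ x : ℂˣ) : ℂ)‖ ≠ 1) →
            (∀ x : (UnitaryGroup.LocalRing L v)ˣ, unitModulusChar (UnitaryGroup.LocalRing L v) x < 1 → ‖((χ₁ x : ℂˣ) : ℂ)‖ < 1) →
            ¬ (∀ u ∈ (Submonoid.pi Set.univ (fun w : PlacesOver L v => (w.1.adicCompletionIntegers L).toSubring.toSubmonoid)).units, χ₁ u = 1) →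
            (∃ u : (UnitaryGroup.LocalRing L v)ˣ, (∀ w' : PlacesOver L v, Valued.v (((u : UnitaryGroup.LocalRing L v) w') - 1) < 1) ∧ χ₁ u ≠ 1) →
            (∀ u : (UnitaryGroup.LocalRing L v)ˣ, (∀ w' : PlacesOver L v, Valued.v ((u : UnitaryGroup.LocalRing L v) w') = 1) →
              χ₁ (u * Units.map (conjLocal L (IsCMField.complexConj L) v : UnitaryGroup.LocalRing L v →* UnitaryGroup.LocalRing L v) u) = 1) →
            (∃ N : Subrepresentation (UnitaryGroup.cmPrincipalSeries L 3 v (UnitaryGroup.cmTorusCharPair L v χ₁ 1)), N ≠ ⊥ ∧ N ≠ ⊤) →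
            χ₁ = halfModulusChar (UnitaryGroup.LocalRing L v) * halfModulusChar (UnitaryGroup.LocalRing L v) ∨
            (∃ η : (UnitaryGroup.LocalRing L v)ˣ →* ℂˣ, IsQuadraticCharExtension (conjLocal L (IsCMField.complexConj L) v) η ∧
              Continuous (fun x => ((η x : ℂˣ) : ℂ)) ∧ χ₁ = η * halfModulusChar (UnitaryGroup.LocalRing L v)))
    (hSRT :
      ∀ (L : Type) [Field L] [NumberField L] [IsCMField L] (v : HeightOneSpectrum (𝓞 ↥(maximalRealSubfield L))),
          (∀ w : PlacesOver L v, IsCMField.complexConj L • w.1 = w.1) →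
          ¬ Algebra.IsUnramifiedIn (𝓞 L) v.asIdeal →
          (∀ w' : PlacesOver L v, Valued.v (2 : w'.1.adicCompletion L) = 1) →
          ∀ (χ₁ : (UnitaryGroup.LocalRing L v)ˣ →* ℂˣ),
            Continuous (fun x => ((χ₁ x : ℂˣ) : ℂ)) → (∃ x, ‖((χ₁ x : ℂˣ) : ℂ)‖ ≠ 1) →
            (∀ x : (UnitaryGroup.LocalRing L v)ˣ, unitModulusChar (UnitaryGroup.LocalRing L v) x < 1 → ‖((χ₁ x : ℂˣ) : ℂ)‖ < 1) →
            ¬ (∀ u ∈ (Submonoid.pi Set.univ (fun w : PlacesOver L v => (w.1.adicCompletionIntegers L).toSubring.toSubmonoid)).units, χ₁ u = 1) →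
            (∃ u : (UnitaryGroup.LocalRing L v)ˣ, (∀ w' : PlacesOver L v, Valued.v (((u : UnitaryGroup.LocalRing L v) w') - 1) < 1) ∧ χ₁ u ≠ 1) →
            (∀ u : (UnitaryGroup.LocalRing L v)ˣ, (∀ w' : PlacesOver L v, Valued.v ((u : UnitaryGroup.LocalRing L v) w') = 1) →
              χ₁ (u * Units.map (conjLocal L (IsCMField.complexConj L) v : UnitaryGroup.LocalRing L v →* UnitaryGroup.LocalRing L v) u) = 1) →
            (∃ N : Subrepresentation (UnitaryGroup.cmPrincipalSeries L 3 v (UnitaryGroup.cmTorusCharPair L v χ₁ 1)), N ≠ ⊥ ∧ N ≠ ⊤) →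
            χ₁ = halfModulusChar (UnitaryGroup.LocalRing L v) * halfModulusChar (UnitaryGroup.LocalRing L v) ∨
            (∃ η : (UnitaryGroup.LocalRing L v)ˣ →* ℂˣ, IsQuadraticCharExtension (conjLocal L (IsCMField.complexConj L) v) η ∧
              Continuous (fun x => ((η x : ℂˣ) : ℂ)) ∧ χ₁ = η * halfModulusChar (UnitaryGroup.LocalRing L v)))
    (hSW :
      ∀ (L : Type) [Field L] [NumberField L] [IsCMField L] (v : HeightOneSpectrum (𝓞 ↥(maximalRealSubfield L))),
          (∀ w : PlacesOver L v, IsCMField.complexConj L • w.1 = w.1) →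
          ¬ Algebra.IsUnramifiedIn (𝓞 L) v.asIdeal →
          ¬ (∀ w' : PlacesOver L v, Valued.v (2 : w'.1.adicCompletion L) = 1) →
          ∀ (χ₁ : (UnitaryGroup.LocalRing L v)ˣ →* ℂˣ),
            Continuous (fun x => ((χ₁ x : ℂˣ) : ℂ)) → (∃ x, ‖((χ₁ x : ℂˣ) : ℂ)‖ ≠ 1) →
            (∀ x : (UnitaryGroup.LocalRing L v)ˣ, unitModulusChar (UnitaryGroup.LocalRing L v) x < 1 → ‖((χ₁ x : ℂˣ) : ℂ)‖ < 1) →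
            ¬ (∀ u ∈ (Submonoid.pi Set.univ (fun w : PlacesOver L v => (w.1.adicCompletionIntegers L).toSubring.toSubmonoid)).units, χ₁ u = 1) →
            (∃ u : (UnitaryGroup.LocalRing L v)ˣ, (∀ w' : PlacesOver L v, Valued.v (((u : UnitaryGroup.LocalRing L v) w') - 1) < 1) ∧ χ₁ u ≠ 1) →
            (∃ N : Subrepresentation (UnitaryGroup.cmPrincipalSeries L 3 v (UnitaryGroup.cmTorusCharPair L v χ₁ 1)), N ≠ ⊥ ∧ N ≠ ⊤) →
            χ₁ = halfModulusChar (UnitaryGroup.LocalRing L v) * halfModulusChar (UnitaryGroup.LocalRing L v) ∨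
            (∃ η : (UnitaryGroup.LocalRing L v)ˣ →* ℂˣ, IsQuadraticCharExtension (conjLocal L (IsCMField.complexConj L) v) η ∧
              Continuous (fun x => ((η x : ℂˣ) : ℂ)) ∧ χ₁ = η * halfModulusChar (UnitaryGroup.LocalRing L v))) :
    ∀ (L : Type) [Field L] [NumberField L] [IsCMField L] (v : HeightOneSpectrum (𝓞 ↥(maximalRealSubfield L))),
        (∀ w : PlacesOver L v, IsCMField.complexConj L • w.1 = w.1) →
        ∀ (χ₁ : (UnitaryGroup.LocalRing L v)ˣ →* ℂˣ),
          Continuous (fun x => ((χ₁ x : ℂˣ) : ℂ)) → (∃ x, ‖((χ₁ x : ℂˣ) : ℂ)‖ ≠ 1) →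
          (∀ x : (UnitaryGroup.LocalRing L v)ˣ, unitModulusChar (UnitaryGroup.LocalRing L v) x < 1 → ‖((χ₁ x : ℂˣ) : ℂ)‖ < 1) →
          ¬ (∀ u ∈ (Submonoid.pi Set.univ (fun w : PlacesOver L v => (w.1.adicCompletionIntegers L).toSubring.toSubmonoid)).units, χ₁ u = 1) →
          (∃ u : (UnitaryGroup.LocalRing L v)ˣ, (∀ w' : PlacesOver L v, Valued.v (((u : UnitaryGroup.LocalRing L v) w') - 1) < 1) ∧ χ₁ u ≠ 1) →
          (∃ N : Subrepresentation (UnitaryGroup.cmPrincipalSeries L 3 v (UnitaryGroup.cmTorusCharPair L v χ₁ 1)), N ≠ ⊥ ∧ N ≠ ⊤) →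
          χ₁ = halfModulusChar (UnitaryGroup.LocalRing L v) * halfModulusChar (UnitaryGroup.LocalRing L v) ∨
          (∃ η : (UnitaryGroup.LocalRing L v)ˣ →* ℂˣ, IsQuadraticCharExtension (conjLocal L (IsCMField.complexConj L) v) η ∧
            Continuous (fun x => ((η x : ℂˣ) : ℂ)) ∧ χ₁ = η * halfModulusChar (UnitaryGroup.LocalRing L v)) := by
  intro L _ _ _ v hns χ₁ h₁ hnu hcontr hram hpos hred
  by_cases hunr : Algebra.IsUnramifiedIn (𝓞 L) v.asIdeal
  · -- UNRAMIFIED (inert) non-split place: Branch B ⟶ letter `hSI`; Branch A is ABSURD by ★ TwoDepthLeaf with the integral trace-one element of ★ TraceOneLetter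
    by_cases hB : ∀ u : (UnitaryGroup.LocalRing L v)ˣ, (∀ w' : PlacesOver L v, Valued.v ((u : UnitaryGroup.LocalRing L v) w') = 1) →
          χ₁ (u * Units.map (conjLocal L (IsCMField.complexConj L) v : UnitaryGroup.LocalRing L v →* UnitaryGroup.LocalRing L v) u) = 1
    · exact hSI L v hns hunr χ₁ h₁ hnu hcontr hram hpos hB hred
    · push Not at hB
      obtain ⟨u, hu, hA⟩ := hB
      obtain ⟨t, ht, hvt⟩ := K2E3LocalTraceOneLetter.exists_traceOne_local_of_isUnramifiedIn_of_nonsplit L v hns hunr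
      exact absurd hred
        (K2E3BranchAIrreducibleTwoDepthLeaf.not_reducible_of_posDepth_of_normChar_ne_one_of_traceOne L v hns χ₁ h₁ hnu hcontr hpos t ht hvt u hu hA)
  · by_cases h2 : ∀ w' : PlacesOver L v, Valued.v (2 : w'.1.adicCompletion L) = 1
    · -- TAMELY RAMIFIED place: Branch B ⟶ letter `hSRT`; Branch A is ABSURD by ★ TwoDepthLeaf with `t := 2⁻¹`
      by_cases hB : ∀ u : (UnitaryGroup.LocalRing L v)ˣ, (∀ w' : PlacesOver L v, Valued.v ((u : UnitaryGroup.LocalRing L v) w') = 1) →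
            χ₁ (u * Units.map (conjLocal L (IsCMField.complexConj L) v : UnitaryGroup.LocalRing L v →* UnitaryGroup.LocalRing L v) u) = 1
      · exact hSRT L v hns hunr h2 χ₁ h₁ hnu hcontr hram hpos hB hred
      · push Not at hB
        obtain ⟨u, hu, hA⟩ := hB
        exact absurd hred
          (K2E3BranchAIrreducibleTwoDepthLeaf.not_reducible_of_posDepth_of_normChar_ne_one_of_v_two L v hns χ₁ h₁ hnu hcontr hpos h2 u hu hA)
    · -- WILDLY RAMIFIED (dyadic) place, both branches ⟶ letter `hSW`
      exact hSW L v hns hunr h2 χ₁ h₁ hnu hcontr hram hpos hred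

end Summit.HodgeConjecture.HodgeConjecture.R90.S1

end
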